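import Summits.AtomisticToContinuum.HydrodynamicLimit.Theorems.MourreKoopmanChargesStressStrongMixingSplit
import HarnessLib

/-!
# Line `split3` for crux `StressStrongMixing` (stmt-AtomisticToContinuum-9584) — the STAFFABLE
# THREE-NODE QUOTIENT of the live line `birth` (lead c4), with the composition ALREADY LANDED.

Strategist seat `cstrat-stmt-AtomisticToContinuum-9584-s1`, 2026-08-17.  This is NOT an alternative
mechanism: it is the minimal cut of the lead's skeleton (`Lines/birth.lean`,
`StressStrongMixing_of_direct`) promoted to three named nodes whose join
`A → B → C → StressStrongMixing` is the sorry-free landed theorem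
`Summit.AtomisticToContinuum.HydrodynamicLimit.Theorems.MourreKoopmanChargesStressStrongMixingSplit.StressStrongMixing_of_subs`
(p171764).  The three stubs below are VERBATIM the children of the proposed route-level split
(`children.json` in `Lines/split3.md`; `ledger route edit … --split StressStrongMixing` is refused to
non-final-cycle seats, so the split is parked here for the lead's final cycle / the tenure planner).

* `stub_stressFrameworkDensityOne`  (A) — existence of a density-one Spohn fluctuation framework
  carrying the kinetic shear stress (Alexander flow a.e. + space-time clustering); lead stubs
  `stub_alexanderFlow` + `stub_flowLocalityDominated` ⇒ A via the lead's landed `stressFramework_of_min`.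
* `stub_torusStressIdentificationAll` (B) — torus two-time stress moment → ⟪U_s ξ_Π, ξ_Π⟫_ℋ · ∫χ₁χ₂
  for every s > 0 on every such framework; lead stub `stub_torusStressDiagonalLimit` ⇒ B via the landed
  TrigReduction (p169373) + PosOfTrig (p167024).
* `stub_stressRajchmanDecay` (C) — ⟪U_s ξ_Π, ξ_Π⟫_ℋ → 0 (Rajchman property of the stress spectral
  measure): the open-problem content (Spohn 1991 Part I §7.2 p. 94); lead stub
  `stub_stressSpectralDensity` (a.c. density, C1) ⇒ C by Riemann–Lebesgue.

Probes (folder `bc/probe_*.lean`, battery `exact? | simpa | unfold+simpa | aesop | simp_all`,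
400 000 heartbeats): A ↛ crux, B ↛ crux, C ↛ crux, A/B/C ↛ `HydrodynamicLimit`, none provable
outright, A∧B ↛ crux, A∧C ↛ crux (all `unsolved goals`); B∧C → crux timed out (not a pass; without a
framework B and C are silent).
-/

namespace Summit.AtomisticToContinuum.HydrodynamicLimit.Cruxes.StressStrongMixing.Split3

open scoped BigOperators Topology MeasureTheory ProbabilityTheory InnerProductSpace
open Filter MeasureTheory

/-- **Stub A — `StressFrameworkDensityOne`.**  For all small reduced diameters and every
temperature there is an activity `z > 0` and hard-sphere fluctuation data `F` (Spohn's framework: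
translation-invariant state, a.e. flow, flow/shift-stable local observables with summable truncated
correlations) whose state is the DLR Gibbs state `(σ, z, θ⁻¹, 0)` of density one, whose flow is
a.e. an equilibrium Alexander flow, and whose local observables contain the kinetic shear stress. -/
theorem stub_stressFrameworkDensityOne :
    ∃ σ₀ : ℝ, 0 < σ₀ ∧ ∀ σ : ℝ, 0 < σ → σ < σ₀ → ∀ θ : ℝ, 0 < θ → ∃ z : ℝ, 0 < z ∧ ∃ F : Literature.MathematicalPhysics.KineticTheory.HardSphereFluctuationData σ, Literature.Analysis.FluidPDE.IsHardSphereGibbs σ z θ⁻¹ (0 : Literature.MathematicalPhysics.KineticTheory.V3) F.μ ∧ (∫ ω, Literature.MathematicalPhysics.KineticTheory.cellCharge 0 ω ∂F.μ = 1) ∧ (∃ Φ : Literature.Analysis.FluidPDE.InfiniteHardSphereFlow (Fin 3) σ, Φ.IsEquilibriumFlow ∧ ∀ t : ℝ, F.flow t =ᵐ[F.μ] Φ.flow t) ∧ Literature.MathematicalPhysics.KineticTheory.cellObs (fun v : Literature.MathematicalPhysics.KineticTheory.V3 => v 0 * v 1) ∈ F.localObs := by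
  sorry

/-- **Stub B — `TorusStressIdentificationAll`.**  Finite → infinite volume at positive kinetic
times: on every density-one framework the crux's torus two-time stress moment converges, for every
flow family, continuous `χ₁, χ₂` and `s > 0`, to `⟪U_s ξ_Π, ξ_Π⟫_ℋ · ∫ χ₁ χ₂`. -/
theorem stub_torusStressIdentificationAll :
    ∃ σ₀ : ℝ, 0 < σ₀ ∧ ∀ σ : ℝ, 0 < σ → σ < σ₀ → ∀ θ : ℝ, 0 < θ → ∀ z : ℝ, 0 < z → ∀ F : Literature.MathematicalPhysics.KineticTheory.HardSphereFluctuationData σ, (Literature.Analysis.FluidPDE.IsHardSphereGibbs σ z θ⁻¹ (0 : Literature.MathematicalPhysics.KineticTheory.V3) F.μ ∧ (∫ ω, Literature.MathematicalPhysics.KineticTheory.cellCharge 0 ω ∂F.μ = 1) ∧ (∃ Φ : Literature.Analysis.FluidPDE.InfiniteHardSphereFlow (Fin 3) σ, Φ.IsEquilibriumFlow ∧ ∀ t : ℝ, F.flow t =ᵐ[F.μ] Φ.flow t) ∧ Literature.MathematicalPhysics.KineticTheory.cellObs (fun v : Literature.MathematicalPhysics.KineticTheory.V3 => v 0 * v 1)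 ∈ F.localObs) → ∀ Φ : (N : ℕ) → Literature.Analysis.FluidPDE.HardSphereFlow (Literature.Analysis.FluidPDE.Torus.geometry (Fin 3)) (Literature.MathematicalPhysics.KineticTheory.hsDiameter σ N) (N + 1), ∀ χ₁ χ₂ : Literature.MathematicalPhysics.KineticTheory.T3 → ℝ, Continuous χ₁ → Continuous χ₂ → ∀ s : ℝ, 0 < s → Filter.Tendsto (fun N : ℕ => ((N : ℝ) + 1) * ∫ z, (∫ y, χ₁ y.1 * (y.2 0 * y.2 1) ∂(Literature.Analysis.FluidPDE.empiricalMeasure ((Φ N).flow (s * ((N : ℝ) + 1) ^ (-(1 / 3 : ℝ))) z))) * (∫ y, χ₂ y.1 * (y.2 0 * y.2 1) ∂(Literature.Analysis.FluidPDE.empiricalMeasure z)) ∂(Literature.MathematicalPhysics.KineticTheory.localGibbsLaw σ (fun _ => 1) (fun _ => 0) (fun _ => θ) N (Φ N))) Filter.atTop (nhds (⟪F.koopman s (F.fluct (Literature.MathematicalPhysics.KineticTheory.cellObs fun v : Literature.MathematicalPhysics.KineticTheory.V3 => v 0 * v 1)), F.fluct (Literature.MathematicalPhysics.KineticTheory.cellObs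 fun v : Literature.MathematicalPhysics.KineticTheory.V3 => v 0 * v 1)⟫_ℝ * ∫ x, χ₁ x * χ₂ x)) := by
  sorry

/-- **Stub C — `StressRajchmanDecay`.**  On every density-one framework the `k = 0` stress
autocorrelation `s ↦ ⟪U_s ξ_Π, ξ_Π⟫_ℋ` tends to `0` (the Green–Kubo integrand of the kinetic shear
viscosity decays; `c(0) = θ²` is landed, p158174). -/
theorem stub_stressRajchmanDecay :
    ∃ σ₀ : ℝ, 0 < σ₀ ∧ ∀ σ : ℝ, 0 < σ → σ < σ₀ → ∀ θ : ℝ, 0 < θ → ∀ z : ℝ, 0 < z → ∀ F : Literature.MathematicalPhysics.KineticTheory.HardSphereFluctuationData σ, (Literature.Analysis.FluidPDE.IsHardSphereGibbs σ z θ⁻¹ (0 : Literature.MathematicalPhysics.KineticTheory.V3) F.μ ∧ (∫ ω, Literature.MathematicalPhysics.KineticTheory.cellCharge 0 ω ∂F.μ = 1) ∧ (∃ Φ : Literature.Analysis.FluidPDE.InfiniteHardSphereFlow (Fin 3) σ, Φ.IsEquilibriumFlow ∧ ∀ t : ℝ, F.flow t =ᵐ[F.μ] Φ.flow t) ∧ Literature.MathematicalPhysics.KineticTheory.cellObs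 (fun v : Literature.MathematicalPhysics.KineticTheory.V3 => v 0 * v 1) ∈ F.localObs) → Filter.Tendsto (fun s : ℝ => ⟪F.koopman s (F.fluct (Literature.MathematicalPhysics.KineticTheory.cellObs fun v : Literature.MathematicalPhysics.KineticTheory.V3 => v 0 * v 1)), F.fluct (Literature.MathematicalPhysics.KineticTheory.cellObs fun v : Literature.MathematicalPhysics.KineticTheory.V3 => v 0 * v 1)⟫_ℝ) Filter.atTop (nhds 0) := by
  sorry

/-- The composition: the three stubs give the crux BY NAME, through the landed glue (p171764). -/
theorem StressStrongMixing_of :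
    (∃ σ₀ : ℝ, 0 < σ₀ ∧ ∀ σ : ℝ, 0 < σ → σ < σ₀ → ∀ θ : ℝ, 0 < θ → ∃ z : ℝ, 0 < z ∧ ∃ F : Literature.MathematicalPhysics.KineticTheory.HardSphereFluctuationData σ, Literature.Analysis.FluidPDE.IsHardSphereGibbs σ z θ⁻¹ (0 : Literature.MathematicalPhysics.KineticTheory.V3) F.μ ∧ (∫ ω, Literature.MathematicalPhysics.KineticTheory.cellCharge 0 ω ∂F.μ = 1) ∧ (∃ Φ : Literature.Analysis.FluidPDE.InfiniteHardSphereFlow (Fin 3) σ, Φ.IsEquilibriumFlow ∧ ∀ t : ℝ, F.flow t =ᵐ[F.μ] Φ.flow t) ∧ Literature.MathematicalPhysics.KineticTheory.cellObs (fun v : Literature.MathematicalPhysics.KineticTheory.V3 => v 0 * v 1) ∈ F.localObs) →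
    (∃ σ₀ : ℝ, 0 < σ₀ ∧ ∀ σ : ℝ, 0 < σ → σ < σ₀ → ∀ θ : ℝ, 0 < θ → ∀ z : ℝ, 0 < z → ∀ F : Literature.MathematicalPhysics.KineticTheory.HardSphereFluctuationData σ, (Literature.Analysis.FluidPDE.IsHardSphereGibbs σ z θ⁻¹ (0 : Literature.MathematicalPhysics.KineticTheory.V3) F.μ ∧ (∫ ω, Literature.MathematicalPhysics.KineticTheory.cellCharge 0 ω ∂F.μ = 1) ∧ (∃ Φ : Literature.Analysis.FluidPDE.InfiniteHardSphereFlow (Fin 3) σ, Φ.IsEquilibriumFlow ∧ ∀ t : ℝ, F.flow t =ᵐ[F.μ] Φ.flow t) ∧ Literature.MathematicalPhysics.KineticTheory.cellObs (fun v : Literature.MathematicalPhysics.KineticTheory.V3 => v 0 * v 1) ∈ F.localObs) → ∀ Φ : (N : ℕ) → Literature.Analysis.FluidPDE.HardSphereFlow (Literature.Analysis.FluidPDE.Torus.geometry (Fin 3)) (Literature.MathematicalPhysics.KineticTheory.hsDiameter σ N) (N + 1), ∀ χ₁ χ₂ : Literature.MathematicalPhysics.KineticTheory.T3 → ℝ,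 Continuous χ₁ → Continuous χ₂ → ∀ s : ℝ, 0 < s → Filter.Tendsto (fun N : ℕ => ((N : ℝ) + 1) * ∫ z, (∫ y, χ₁ y.1 * (y.2 0 * y.2 1) ∂(Literature.Analysis.FluidPDE.empiricalMeasure ((Φ N).flow (s * ((N : ℝ) + 1) ^ (-(1 / 3 : ℝ))) z))) * (∫ y, χ₂ y.1 * (y.2 0 * y.2 1) ∂(Literature.Analysis.FluidPDE.empiricalMeasure z)) ∂(Literature.MathematicalPhysics.KineticTheory.localGibbsLaw σ (fun _ => 1) (fun _ => 0) (fun _ => θ) N (Φ N))) Filter.atTop (nhds (⟪F.koopman s (F.fluct (Literature.MathematicalPhysics.KineticTheory.cellObs fun v : Literature.MathematicalPhysics.KineticTheory.V3 => v 0 * v 1)), F.fluct (Literature.MathematicalPhysics.KineticTheory.cellObs fun v : Literature.MathematicalPhysics.KineticTheory.V3 => v 0 * v 1)⟫_ℝ * ∫ x, χ₁ x * χ₂ x))) →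
    (∃ σ₀ : ℝ, 0 < σ₀ ∧ ∀ σ : ℝ, 0 < σ → σ < σ₀ → ∀ θ : ℝ, 0 < θ → ∀ z : ℝ, 0 < z → ∀ F : Literature.MathematicalPhysics.KineticTheory.HardSphereFluctuationData σ, (Literature.Analysis.FluidPDE.IsHardSphereGibbs σ z θ⁻¹ (0 : Literature.MathematicalPhysics.KineticTheory.V3) F.μ ∧ (∫ ω, Literature.MathematicalPhysics.KineticTheory.cellCharge 0 ω ∂F.μ = 1) ∧ (∃ Φ : Literature.Analysis.FluidPDE.InfiniteHardSphereFlow (Fin 3) σ, Φ.IsEquilibriumFlow ∧ ∀ t : ℝ, F.flow t =ᵐ[F.μ] Φ.flow t) ∧ Literature.MathematicalPhysics.KineticTheory.cellObs (fun v : Literature.MathematicalPhysics.KineticTheory.V3 => v 0 * v 1) ∈ F.localObs) → Filter.Tendsto (fun s : ℝ => ⟪F.koopman s (F.fluct (Literature.MathematicalPhysics.KineticTheory.cellObs fun v : Literature.MathematicalPhysics.KineticTheory.V3 => v 0 * v 1)), F.fluct (Literature.MathematicalPhysics.KineticTheory.cellObs fun v : Literature.MathematicalPhysics.KineticTheory.V3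 => v 0 * v 1)⟫_ℝ) Filter.atTop (nhds 0)) →
    Summit.AtomisticToContinuum.HydrodynamicLimit.Theses.MourreKoopmanCharges.StressStrongMixing :=
  Summit.AtomisticToContinuum.HydrodynamicLimit.Theorems.MourreKoopmanChargesStressStrongMixingSplit.StressStrongMixing_of_subs

/-- Sanity: the stubs compose to the crux. -/
theorem StressStrongMixing_of_stubs :
    Summit.AtomisticToContinuum.HydrodynamicLimit.Theses.MourreKoopmanCharges.StressStrongMixing :=
  StressStrongMixing_of stub_stressFrameworkDensityOne stub_torusStressIdentificationAll
    stub_stressRajchmanDecay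

end Summit.AtomisticToContinuum.HydrodynamicLimit.Cruxes.StressStrongMixing.Split3
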